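import Summits.HodgeConjecture.HodgeConjecture.Theorems.R90S6TreeNormalFrameU2          -- ★ this seat (HF1 A1): `formCongr_antidiagonal_two_apply_zero_zero`; brings `isUnimodular₂_antidiagonal_two`, `valuation_map_eq_of_datum`, the `Valued`∕`ValuativeRel` bridge
import Literature.NumberTheory.Automorphic.UnitaryTwoIwahoriStarFixedPoints              -- ★ (R3c) B-p04: `natCard_antifixed_residueField_eq` (`#{t ∈ 𝓀 : τ t = −t} = q`); brings ★ `residue_eq_zero_iff_valuation_lt_one`
import Literature.NumberTheory.Automorphic.HermitianLatticeTreeFlagTransitive             -- ★ B-p04: `exists_eq_latt_mul_diagonal_of_isModularLattice` (the root star in a frame), `mem_glInt_of_coe_eq_antidiag`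
import HarnessLib

/-!
# R90 · S6 — CARD «REG2», FILE 1: THE STAR OF THE ROOT OF `X₂` — the neighbours of `𝒪²` are `Λ_t = ϖ𝒪² + 𝒪(1,t)` (`t + σt ∈ 𝔪`) and `Λ_∞ = ϖ𝒪² + 𝒪(0,1)`
# (`Theorems/R90S6UnitaryTwoRootStar.lean`)

Cell `hodgecm-mathlib`, crux H413 (`stmt-HodgeConjecture-24833`), route of record `HCCMUnconditional`; programme R90-TF, section S6 (base `R90-C14`), seat
R90-C14-p03 (g3); card «REG2» (dealer R90-C14-plan (g2), R90 bus 2026-09-05T03:11:42Z; consumers G1 (p02), G2, G5, FIN).  Helper lane `--supports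
stmt-HodgeConjecture-24833 --as helper`; THEOREMS ONLY (no definition, no instance, no notation, no named fact, no `sorry`).  FILE 2 `R90S6UnitaryTwoTreeRegular`
counts the star (`q + 1`, ★ `natCard_antifixed_residueField_eq`) and transports it to every vertex.

SETTING.  `K : Type` with `Valued K ℤᵐ⁰` and `ValuativeRel K` compatible, `hd : UnramifiedLocalConjDatum σ ϖ`, `J₂ = (StdForm.antidiagonal 2).over K = antidiag(1,1)`,
`X₂ = latticeTree σ ϖ J₂` (★ `HermitianLatticeTree*`), root `x₀.1 = latt 1 = 𝒪²`.  RESIDUAL LETTERS (VERBATIM the ★ (R3c) `UnitaryTwoIwahoriStarFixedPoints` shape,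
`ValuativeRel` currency): `σO : 𝒪[K] →+* 𝒪[K]` the restriction of `σ` (`hσO'`), the reduction `τ : 𝓀[K] →+* 𝓀[K]` of `σO` (`hτ`).

THE MATHEMATICS (Serre, *Trees*, II.1.1: the star of a vertex is the projective line of the residue field; here its ISOTROPIC points).  For `t ∈ 𝒪` put
`Λ_t = latt (!![1,0;t,1]·diag(1,ϖ)) = ϖ𝒪² + 𝒪(1,t)` and `Λ_∞ = latt (antidiag·diag(1,ϖ)) = ϖ𝒪² + 𝒪(0,1)` (frames in the ★ `latt (P·diag(ϖ⁰, ϖ¹))` shape).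
* `latticeTree_adj_root_latt_lowerUnipotent`: `Λ_t` is a neighbour of the root when `τ t̄ = −t̄` (★ `isModularLattice_frame_iff`: the `(0,0)` Gram entry is `t + σt ∈ 𝔪`);
  `latticeTree_adj_root_latt_antidiag`: so is `Λ_∞`.
* `exists_eq_latt_lowerUnipotent_or_antidiag_of_adj_root`: EVERY neighbour is a `Λ_t` (`τ t̄ = −t̄`) or `Λ_∞` — by ★ `exists_eq_latt_mul_diagonal_of_isModularLattice` a neighbour
  is `latt (P·diag(1,ϖ))`, `P ∈ GL₂(𝒪)` with residually isotropic first column `(x, y)`; `(L_{y∕x}·D)·!![x, ϖP₀₁; 0, P₁₁ − (y∕x)P₀₁] = P·D` if `x` is a unit, and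
  `(antidiag·D)·!![y, ϖP₁₁; x∕ϖ, P₀₁] = P·D` if `x ∈ 𝔪` (then `y` is a unit), the right factors in `GL₂(𝒪)`.
* `latt_lowerUnipotent_eq_iff`: `Λ_t = Λ_{t′} ↔ t̄ = t̄′` and `Λ_t ≠ Λ_∞` (read the entries of `L_{t′}·D = (L_t·D)·k`, `k ∈ GL₂(𝒪)`).
HONEST LABEL: lattice∕residue bookkeeping over ★ carriers; proves no printed global statement, discharges no citation; count-neutral helper.
HC_CM is proved only modulo the 7 printed citations (2 remaining named inputs: hLiu418 = stmt-HodgeConjecture-24832, h413 = stmt-HodgeConjecture-24833) until rung 0 closes; REL ≠ ★ ≠ BUILT.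

## References
* [Serre1980Trees] J.-P. Serre, *Trees* (1980): II.1.1 (the tree of a rank-one group over a local field; the star of a vertex).
* [BruhatTits1972] F. Bruhat, J. Tits, *Groupes réductifs sur un corps local I*, Publ. Math. IHÉS 41 (1972): §10.
* [Kottwitz1988] R. E. Kottwitz, *Tamagawa numbers*, Ann. of Math. 127 (1988): §2 (the tree of the unramified `U(1,1)`).
* [Jacobowitz1962] R. Jacobowitz, *Hermitian forms over local fields*, Amer. J. Math. 84 (1962): §7–§8 (unimodular and `𝔭`-modular lattices).
-/

set_option autoImplicit false
-- the mandated namespace repeats the single-problem summit's segment (`HodgeConjecture.HodgeConjecture`)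
set_option linter.dupNamespace false

noncomputable section

open Set Function
open scoped ValuativeRel Matrix MatrixGroups
open SimpleGraph Matrix ValuativeRel
open Literature.NumberTheory.Automorphic
open Literature.NumberTheory.Automorphic.HermitianLatticeTree
open Literature.Combinatorics.SimpleGraph

namespace Summit.HodgeConjecture.HodgeConjecture.R90.S6

section Two

variable {K : Type} [Field K] [Valued K (WithZero (Multiplicative ℤ))] [ValuativeRel K]
  [(Valued.v : Valuation K (WithZero (Multiplicative ℤ))).Compatible] {σ : K →+* K} {ϖ : K}

/-! ## §1 The root star: `Λ_t = latt (!![1,0;t,1]·diag(1,ϖ))` (`t + σt ∈ 𝔪`) and `Λ_∞ = latt (antidiag·diag(1,ϖ))` -/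

omit [Valued K (WithZero (Multiplicative ℤ))] [ValuativeRel K] [(Valued.v : Valuation K (WithZero (Multiplicative ℤ))).Compatible] in
/-- The Gram entries of a frame for `J₂ = antidiag(1,1)`: `((σP)ᵀ J₂ P)ᵢⱼ = σ(P₀ᵢ) P₁ⱼ + σ(P₁ᵢ) P₀ⱼ`. [cite: Jacobowitz1962, §7] -/
theorem formCongr_antidiagonal_two_apply (P : GL (Fin 2) K) (i j : Fin 2) :
    formCongr σ P ((StdForm.antidiagonal 2).over K) i j =
      σ ((P : Matrix (Fin 2) (Fin 2) K) 0 i) * (P : Matrix (Fin 2) (Fin 2) K) 1 j + σ ((P : Matrix (Fin 2) (Fin 2) K) 1 i) * (P : Matrix (Fin 2) (Fin 2) K) 0 j := by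
  rw [formCongr, UnitaryGroup.Two.antidiagonal_two_over_eq]
  simp [Matrix.mul_apply, Fin.sum_univ_two]
  ring

omit [Valued K (WithZero (Multiplicative ℤ))] [(Valued.v : Valuation K (WithZero (Multiplicative ℤ))).Compatible] in
/-- The lower unipotent `!![1,0;t,1]` (`t ∈ 𝒪`) as an element of `GL₂(𝒪)`. [cite: Serre1980Trees, II.1.1] -/
theorem exists_glInt_coe_eq_lowerUnipotent_two (t : 𝒪[K]) :
    ∃ L : GL (Fin 2) K, L ∈ glInt 2 K ∧ (L : Matrix (Fin 2) (Fin 2) K) = !![(1 : K), 0; (t : K), 1] := by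
  have hdet : (!![(1 : K), 0; (t : K), 1]).det = 1 := by rw [Matrix.det_fin_two_of]; ring
  refine ⟨Matrix.GeneralLinearGroup.mkOfDetNeZero _ (by rw [hdet]; exact one_ne_zero), mem_glInt_of_isIntegralMatrix (fun i j => ?_) ?_, rfl⟩
  · change (!![(1 : K), 0; (t : K), 1]) i j ∈ 𝒪[K]
    fin_cases i <;> fin_cases j
    · exact Subring.one_mem _
    · exact Subring.zero_mem _
    · exact t.2
    · exact Subring.one_mem _
  · change valuation K (!![(1 : K), 0; (t : K), 1]).det = 1
    rw [hdet, map_one]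

/-- **`Λ_t` is a neighbour of the root when `τ t̄ = −t̄`**: `latt (L_t·diag(1,ϖ))` is `ϖ`-modular (Gram entry `t + σt ∈ 𝔪`, ★ `isModularLattice_frame_iff`), lies between
`ϖ𝒪²` and `𝒪²`, hence is adjacent to `x₀ = 𝒪²`. [cite: Serre1980Trees, II.1.1] [cite: Jacobowitz1962, §8] -/
theorem latticeTree_adj_root_latt_lowerUnipotent (hd : HermitianLattice.UnramifiedLocalConjDatum σ ϖ) (σO : 𝒪[K] →+* 𝒪[K])
    (hσO' : ∀ x : 𝒪[K], ((σO x : 𝒪[K]) : K) = σ x) (τ : 𝓀[K] →+* 𝓀[K])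
    (hτ : ∀ x : 𝒪[K], IsLocalRing.residue 𝒪[K] (σO x) = τ (IsLocalRing.residue 𝒪[K] x))
    (x₀ : {M : Submodule 𝒪[K] (Fin 2 → K) // IsSpecialLattice σ ϖ ((StdForm.antidiagonal 2).over K) M})
    (hx₀ : x₀.1 = latt (1 : Matrix (Fin 2) (Fin 2) K)) (t : 𝒪[K]) (ht : τ (IsLocalRing.residue 𝒪[K] t) = -IsLocalRing.residue 𝒪[K] t)
    (L : GL (Fin 2) K) (hL : L ∈ glInt 2 K) (hLt : (L : Matrix (Fin 2) (Fin 2) K) = !![(1 : K), 0; (t : K), 1]) :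
    ∃ hΛ : IsSpecialLattice σ ϖ ((StdForm.antidiagonal 2).over K) (latt ((L : Matrix (Fin 2) (Fin 2) K) * Matrix.diagonal ![ϖ ^ (0 : ℤ), ϖ ^ (1 : ℤ)])),
      (latticeTree σ ϖ ((StdForm.antidiagonal 2).over K)).Adj x₀ ⟨latt ((L : Matrix (Fin 2) (Fin 2) K) * Matrix.diagonal ![ϖ ^ (0 : ℤ), ϖ ^ (1 : ℤ)]), hΛ⟩ := by
  have hσv := valuation_map_eq_of_datum hd
  have hϖ := isUniformizingElement_of_v_eq hd.vϖ
  have hH := isUnimodular₂_antidiagonal_two (K := K)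
  have hv0 : valuation K ϖ ≠ 0 := (Valuation.ne_zero_iff _).2 hϖ.ne_zero
  -- `t + σ t ∈ 𝔪`: `v (t + σ t) < 1`, hence `≤ v ϖ`
  have hres : IsLocalRing.residue 𝒪[K] (σO t + t) = 0 := by rw [map_add, hτ, ht, neg_add_cancel]
  have hlt : valuation K (σ (t : K) + t) < 1 := by
    have h := (residue_eq_zero_iff_valuation_lt_one (σO t + t)).1 hres
    rwa [Subring.coe_add, hσO'] at h
  have hle : valuation K ((t : K) + σ t) ≤ valuation K ϖ := by
    rw [add_comm]
    rw [← v_lt_one_iff_valuation_lt_one] at hlt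
    rw [← v_le_iff_valuation_le, hd.vϖ]
    exact (HermitianLattice.v_lt_one_iff _).1 hlt
  -- modularity in the frame `L`, exponents `(0, 1)`
  have hmod : IsModularLattice σ ϖ ((StdForm.antidiagonal 2).over K) (latt ((L : Matrix (Fin 2) (Fin 2) K) * Matrix.diagonal ![ϖ ^ (0 : ℤ), ϖ ^ (1 : ℤ)])) := by
    rw [isModularLattice_frame_iff σ hσv hϖ hH L hL]
    refine ⟨by norm_num, fun i j => ?_⟩
    rw [formCongr_antidiagonal_two_apply, hLt]
    fin_cases i <;> fin_cases j <;>
      simp only [Fin.zero_eta, Fin.mk_one, Fin.isValue, Matrix.cons_val_zero, Matrix.cons_val_one, Matrix.of_apply, Matrix.cons_val', Matrix.cons_val_fin_one,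
        Matrix.empty_val', map_one, map_zero, one_mul, mul_one, mul_zero, zero_mul, add_zero, zero_add]
    · -- `(0,0)`: `v ϖ ^ (0 − 1) · v (t + σ t) ≤ 1`
      rw [show (0 : ℤ) - 1 = -1 by norm_num, _root_.zpow_neg, zpow_one]
      calc (valuation K ϖ)⁻¹ * valuation K ((t : K) + σ t) ≤ (valuation K ϖ)⁻¹ * valuation K ϖ := mul_le_mul_right hle _
        _ = 1 := inv_mul_cancel₀ hv0
    · rw [sub_self, zpow_zero]
    · rw [sub_self, zpow_zero]
    · exact zero_le
  refine ⟨Or.inr hmod, ?_⟩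
  rw [latticeTree_adj_iff]
  have hsd0 : IsSelfDualLattice σ ((StdForm.antidiagonal 2).over K) x₀.1 := by rw [hx₀]; exact isSelfDualLattice_latt_one σ hH
  refine ⟨fun h => ?_, Or.inl ⟨hsd0, hmod, ?_, ?_⟩⟩
  · have e : x₀.1 = latt ((L : Matrix (Fin 2) (Fin 2) K) * Matrix.diagonal ![ϖ ^ (0 : ℤ), ϖ ^ (1 : ℤ)]) := congrArg Subtype.val h
    exact not_isModularLattice_of_isSelfDualLattice σ hσv hϖ _ (e ▸ hsd0) hmod
  · change scaleLattice ϖ x₀.1 ≤ latt ((L : Matrix (Fin 2) (Fin 2) K) * Matrix.diagonal ![ϖ ^ (0 : ℤ), ϖ ^ (1 : ℤ)])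
    rw [show scaleLattice ϖ x₀.1 = scaleLattice (ϖ ^ (1 : ℤ)) (latt (1 : Matrix (Fin 2) (Fin 2) K)) by rw [zpow_one, hx₀]]
    exact (scaleLattice_zpow_latt_one_le_iff hϖ L hL 0 1 1).2 ⟨by norm_num, le_rfl⟩
  · change latt ((L : Matrix (Fin 2) (Fin 2) K) * Matrix.diagonal ![ϖ ^ (0 : ℤ), ϖ ^ (1 : ℤ)]) ≤ x₀.1
    rw [show x₀.1 = scaleLattice (ϖ ^ (0 : ℤ)) (latt (1 : Matrix (Fin 2) (Fin 2) K)) by rw [zpow_zero, scaleLattice_one, hx₀]]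
    exact (latt_mul_diagonal_le_scaleLattice_zpow_latt_one_iff hϖ L hL 0 1 0).2 ⟨le_rfl, by norm_num⟩

/-- **`Λ_∞ = latt (antidiag·diag(1,ϖ)) = ϖ𝒪² + 𝒪(0,1)` is a neighbour of the root** (Gram entry `(0,0)` of `antidiag` is `0`). [cite: Serre1980Trees, II.1.1] [cite: Jacobowitz1962, §8] -/
theorem latticeTree_adj_root_latt_antidiag (hd : HermitianLattice.UnramifiedLocalConjDatum σ ϖ)
    (x₀ : {M : Submodule 𝒪[K] (Fin 2 → K) // IsSpecialLattice σ ϖ ((StdForm.antidiagonal 2).over K) M})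
    (hx₀ : x₀.1 = latt (1 : Matrix (Fin 2) (Fin 2) K))
    (w : GL (Fin 2) K) (hw : (w : Matrix (Fin 2) (Fin 2) K) = !![(0 : K), 1; 1, 0]) :
    ∃ hΛ : IsSpecialLattice σ ϖ ((StdForm.antidiagonal 2).over K) (latt ((w : Matrix (Fin 2) (Fin 2) K) * Matrix.diagonal ![ϖ ^ (0 : ℤ), ϖ ^ (1 : ℤ)])),
      (latticeTree σ ϖ ((StdForm.antidiagonal 2).over K)).Adj x₀ ⟨latt ((w : Matrix (Fin 2) (Fin 2) K) * Matrix.diagonal ![ϖ ^ (0 : ℤ), ϖ ^ (1 : ℤ)]), hΛ⟩ := by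
  have hσv := valuation_map_eq_of_datum hd
  have hϖ := isUniformizingElement_of_v_eq hd.vϖ
  have hH := isUnimodular₂_antidiagonal_two (K := K)
  have hwI : w ∈ glInt 2 K := mem_glInt_of_coe_eq_antidiag w hw
  have hmod : IsModularLattice σ ϖ ((StdForm.antidiagonal 2).over K) (latt ((w : Matrix (Fin 2) (Fin 2) K) * Matrix.diagonal ![ϖ ^ (0 : ℤ), ϖ ^ (1 : ℤ)])) := by
    rw [isModularLattice_frame_iff σ hσv hϖ hH w hwI]
    have hle1 : ∀ i j, valuation K (formCongr σ w ((StdForm.antidiagonal 2).over K) i j) ≤ 1 := fun i j =>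
      (Valuation.mem_integer_iff _ _).1 ((isUnimodular₂_formCongr_of_mem_glInt σ hσv hH w hwI).1 i j)
    refine ⟨by norm_num, fun i j => ?_⟩
    fin_cases i <;> fin_cases j <;>
      simp only [Fin.zero_eta, Fin.mk_one, Fin.isValue, Matrix.cons_val_zero, Matrix.cons_val_one]
    · rw [formCongr_antidiagonal_two_apply, hw]
      simp
    · rw [show (0 : ℤ) + 1 - 1 = 0 by norm_num, zpow_zero, one_mul]; exact hle1 0 1
    · rw [show (1 : ℤ) + 0 - 1 = 0 by norm_num, zpow_zero, one_mul]; exact hle1 1 0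
    · exact zpow_mul_le_one_of_le hϖ (m := 0) (Or.inr ⟨hle1 1 1, by norm_num⟩) (Or.inr ⟨hle1 1 1, by norm_num⟩)
  refine ⟨Or.inr hmod, ?_⟩
  rw [latticeTree_adj_iff]
  have hsd0 : IsSelfDualLattice σ ((StdForm.antidiagonal 2).over K) x₀.1 := by rw [hx₀]; exact isSelfDualLattice_latt_one σ hH
  refine ⟨fun h => ?_, Or.inl ⟨hsd0, hmod, ?_, ?_⟩⟩
  · have e : x₀.1 = latt ((w : Matrix (Fin 2) (Fin 2) K) * Matrix.diagonal ![ϖ ^ (0 : ℤ), ϖ ^ (1 : ℤ)]) := congrArg Subtype.val h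
    exact not_isModularLattice_of_isSelfDualLattice σ hσv hϖ _ (e ▸ hsd0) hmod
  · change scaleLattice ϖ x₀.1 ≤ latt ((w : Matrix (Fin 2) (Fin 2) K) * Matrix.diagonal ![ϖ ^ (0 : ℤ), ϖ ^ (1 : ℤ)])
    rw [show scaleLattice ϖ x₀.1 = scaleLattice (ϖ ^ (1 : ℤ)) (latt (1 : Matrix (Fin 2) (Fin 2) K)) by rw [zpow_one, hx₀]]
    exact (scaleLattice_zpow_latt_one_le_iff hϖ w hwI 0 1 1).2 ⟨by norm_num, le_rfl⟩
  · change latt ((w : Matrix (Fin 2) (Fin 2) K) * Matrix.diagonal ![ϖ ^ (0 : ℤ), ϖ ^ (1 : ℤ)]) ≤ x₀.1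
    rw [show x₀.1 = scaleLattice (ϖ ^ (0 : ℤ)) (latt (1 : Matrix (Fin 2) (Fin 2) K)) by rw [zpow_zero, scaleLattice_one, hx₀]]
    exact (latt_mul_diagonal_le_scaleLattice_zpow_latt_one_iff hϖ w hwI 0 1 0).2 ⟨le_rfl, by norm_num⟩

/-- **Every neighbour of the root is a `Λ_t` (`τ t̄ = −t̄`) or `Λ_∞`**: by ★ `exists_eq_latt_mul_diagonal_of_isModularLattice` a neighbour is `latt (P·diag(1,ϖ))` with `P ∈ GL₂(𝒪)`
whose first column `(x, y)` is residually isotropic; if `x` is a unit it is `Λ_{y∕x}` (`(L_{y∕x}·D)·!![x, ϖP₀₁; 0, P₁₁ − (y∕x)P₀₁] = P·D`), otherwise `y` is a unit and it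
is `Λ_∞` (`(antidiag·D)·!![y, ϖP₁₁; x∕ϖ, P₀₁] = P·D`). [cite: Serre1980Trees, II.1.1] [cite: Jacobowitz1962, §8] -/
theorem exists_eq_latt_lowerUnipotent_or_antidiag_of_adj_root (hd : HermitianLattice.UnramifiedLocalConjDatum σ ϖ) (σO : 𝒪[K] →+* 𝒪[K])
    (hσO' : ∀ x : 𝒪[K], ((σO x : 𝒪[K]) : K) = σ x) (τ : 𝓀[K] →+* 𝓀[K])
    (hτ : ∀ x : 𝒪[K], IsLocalRing.residue 𝒪[K] (σO x) = τ (IsLocalRing.residue 𝒪[K] x))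
    (x₀ : {M : Submodule 𝒪[K] (Fin 2 → K) // IsSpecialLattice σ ϖ ((StdForm.antidiagonal 2).over K) M})
    (hx₀ : x₀.1 = latt (1 : Matrix (Fin 2) (Fin 2) K))
    (Λ : {M : Submodule 𝒪[K] (Fin 2 → K) // IsSpecialLattice σ ϖ ((StdForm.antidiagonal 2).over K) M})
    (hΛ : (latticeTree σ ϖ ((StdForm.antidiagonal 2).over K)).Adj x₀ Λ) :
    (∃ (t : 𝒪[K]) (L : GL (Fin 2) K), τ (IsLocalRing.residue 𝒪[K] t) = -IsLocalRing.residue 𝒪[K] t ∧ L ∈ glInt 2 K ∧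
        (L : Matrix (Fin 2) (Fin 2) K) = !![(1 : K), 0; (t : K), 1] ∧ Λ.1 = latt ((L : Matrix (Fin 2) (Fin 2) K) * Matrix.diagonal ![ϖ ^ (0 : ℤ), ϖ ^ (1 : ℤ)])) ∨
      ∃ w : GL (Fin 2) K, (w : Matrix (Fin 2) (Fin 2) K) = !![(0 : K), 1; 1, 0] ∧
        Λ.1 = latt ((w : Matrix (Fin 2) (Fin 2) K) * Matrix.diagonal ![ϖ ^ (0 : ℤ), ϖ ^ (1 : ℤ)]) := by
  have hσv := valuation_map_eq_of_datum hd
  have hϖ := isUniformizingElement_of_v_eq hd.vϖ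
  have hϖ0 : ϖ ≠ 0 := hϖ.ne_zero
  have hH := isUnimodular₂_antidiagonal_two (K := K)
  haveI := isDiscreteValuationRing_integer_of_compatible hd.vϖ
  -- `Λ` is modular between `ϖ𝒪²` and `𝒪²`
  have hsd0 : IsSelfDualLattice σ ((StdForm.antidiagonal 2).over K) x₀.1 := by rw [hx₀]; exact isSelfDualLattice_latt_one σ hH
  rw [latticeTree_adj_iff] at hΛ
  obtain ⟨-, h⟩ := hΛ
  have hmod : IsModularLattice σ ϖ ((StdForm.antidiagonal 2).over K) Λ.1 ∧ scaleLattice ϖ (latt (1 : Matrix (Fin 2) (Fin 2) K)) ≤ Λ.1 ∧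
      Λ.1 ≤ latt (1 : Matrix (Fin 2) (Fin 2) K) := by
    rcases h with ⟨-, hm, h1, h2⟩ | ⟨-, hm, -, -⟩
    · rw [hx₀] at h1 h2; exact ⟨hm, h1, h2⟩
    · exact (not_isModularLattice_of_isSelfDualLattice σ hσv hϖ _ hsd0 hm).elim
  obtain ⟨hm, h1, h2⟩ := hmod
  obtain ⟨P, hP, hΛP, h00⟩ := exists_eq_latt_mul_diagonal_of_isModularLattice σ hσv hϖ hH hm h1 h2
  obtain ⟨hPint, hPinv⟩ := (mem_glInt_iff_forall_v_le_one P).1 hP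
  have hdetP : Valued.v (P : Matrix (Fin 2) (Fin 2) K).det = 1 := (v_eq_one_iff_valuation_eq_one _).2 (valuation_det_eq_one_of_mem_glInt hP)
  rw [formCongr_antidiagonal_two_apply_zero_zero] at h00
  have hD : Matrix.diagonal ![ϖ ^ (0 : ℤ), ϖ ^ (1 : ℤ)] = ((zpowDiagGL (n := 2) hϖ0 ![0, 1] : GL (Fin 2) K) : Matrix (Fin 2) (Fin 2) K) :=
    (coe_zpowDiagGL_two hϖ0 0 1).symm
  have hd2 : (Matrix.diagonal ![(1 : K), ϖ]) = !![(1 : K), 0; 0, ϖ] := by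
    ext i j; fin_cases i <;> fin_cases j <;> simp
  by_cases hxu : Valued.v ((P : Matrix (Fin 2) (Fin 2) K) 0 0) = 1
  · -- `((P : Matrix (Fin 2) (Fin 2) K) 0 0)` a unit: `Λ = Λ_{((P : Matrix (Fin 2) (Fin 2) K) 1 0)/((P : Matrix (Fin 2) (Fin 2) K) 0 0)}`
    left
    have hx0 : ((P : Matrix (Fin 2) (Fin 2) K) 0 0) ≠ 0 := fun h => by rw [h, map_zero] at hxu; exact zero_ne_one hxu
    have htO : ((P : Matrix (Fin 2) (Fin 2) K) 1 0) * ((P : Matrix (Fin 2) (Fin 2) K) 0 0)⁻¹ ∈ 𝒪[K] := by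
      rw [← v_le_one_iff_mem_integer, map_mul, map_inv₀, hxu, inv_one, mul_one]; exact hPint 1 0
    obtain ⟨L, hL, hLt⟩ := exists_glInt_coe_eq_lowerUnipotent_two (⟨((P : Matrix (Fin 2) (Fin 2) K) 1 0) * ((P : Matrix (Fin 2) (Fin 2) K) 0 0)⁻¹, htO⟩ : 𝒪[K])
    refine ⟨⟨((P : Matrix (Fin 2) (Fin 2) K) 1 0) * ((P : Matrix (Fin 2) (Fin 2) K) 0 0)⁻¹, htO⟩, L, ?_, hL, hLt, ?_⟩
    · -- residual antisymmetry of `t = ((P : Matrix (Fin 2) (Fin 2) K) 1 0)/((P : Matrix (Fin 2) (Fin 2) K) 0 0)` from the isotropy `v (σ(((P : Matrix (Fin 2) (Fin 2) K) 0 0)) ((P : Matrix (Fin 2) (Fin 2) K) 1 0) + σ(((P : Matrix (Fin 2) (Fin 2) K) 1 0)) ((P : Matrix (Fin 2) (Fin 2) K) 0 0)) < 1`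
      rw [eq_neg_iff_add_eq_zero, ← hτ, ← map_add, residue_eq_zero_iff_valuation_lt_one, Subring.coe_add, hσO']
      change valuation K (σ (((P : Matrix (Fin 2) (Fin 2) K) 1 0) * ((P : Matrix (Fin 2) (Fin 2) K) 0 0)⁻¹) + ((P : Matrix (Fin 2) (Fin 2) K) 1 0) * ((P : Matrix (Fin 2) (Fin 2) K) 0 0)⁻¹) < 1
      have hid : σ (((P : Matrix (Fin 2) (Fin 2) K) 1 0) * ((P : Matrix (Fin 2) (Fin 2) K) 0 0)⁻¹) + ((P : Matrix (Fin 2) (Fin 2) K) 1 0) * ((P : Matrix (Fin 2) (Fin 2) K) 0 0)⁻¹ = (σ ((P : Matrix (Fin 2) (Fin 2) K) 0 0) * ((P : Matrix (Fin 2) (Fin 2) K) 1 0) + σ ((P : Matrix (Fin 2) (Fin 2) K) 1 0) * ((P : Matrix (Fin 2) (Fin 2) K) 0 0)) * ((σ ((P : Matrix (Fin 2) (Fin 2) K) 0 0))⁻¹ * ((P : Matrix (Fin 2) (Fin 2) K) 0 0)⁻¹) := by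
        have hσx0 : σ ((P : Matrix (Fin 2) (Fin 2) K) 0 0) ≠ 0 := fun h => hx0 (by rwa [map_eq_zero] at h)
        rw [map_mul, map_inv₀]; field_simp; ring
      rw [hid, map_mul, map_mul, map_inv₀, map_inv₀, hσv, (v_eq_one_iff_valuation_eq_one ((P : Matrix (Fin 2) (Fin 2) K) 0 0)).1 hxu, inv_one, mul_one, mul_one]
      exact h00
    · rw [hΛP]
      -- `(L·D)·k = P·D` with `k = !![x, ϖ P₀₁; 0, P₁₁ − (y/x) P₀₁] ∈ GL₂(𝒪)`
      have hkdet : (!![((P : Matrix (Fin 2) (Fin 2) K) 0 0), ϖ * (P : Matrix (Fin 2) (Fin 2) K) 0 1; 0, (P : Matrix (Fin 2) (Fin 2) K) 1 1 - ((P : Matrix (Fin 2) (Fin 2) K) 1 0) * ((P : Matrix (Fin 2) (Fin 2) K) 0 0)⁻¹ * (P : Matrix (Fin 2) (Fin 2) K) 0 1]).det =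
          (P : Matrix (Fin 2) (Fin 2) K).det := by
        rw [Matrix.det_fin_two_of, Matrix.det_fin_two]; field_simp; ring
      have hkne : (!![((P : Matrix (Fin 2) (Fin 2) K) 0 0), ϖ * (P : Matrix (Fin 2) (Fin 2) K) 0 1; 0, (P : Matrix (Fin 2) (Fin 2) K) 1 1 - ((P : Matrix (Fin 2) (Fin 2) K) 1 0) * ((P : Matrix (Fin 2) (Fin 2) K) 0 0)⁻¹ * (P : Matrix (Fin 2) (Fin 2) K) 0 1]).det ≠ 0 := by
        rw [hkdet]; exact (Matrix.isUnits_det_units P).ne_zero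
      let k : GL (Fin 2) K := Matrix.GeneralLinearGroup.mkOfDetNeZero _ hkne
      have hk : (k : Matrix (Fin 2) (Fin 2) K) = !![((P : Matrix (Fin 2) (Fin 2) K) 0 0), ϖ * (P : Matrix (Fin 2) (Fin 2) K) 0 1; 0, (P : Matrix (Fin 2) (Fin 2) K) 1 1 - ((P : Matrix (Fin 2) (Fin 2) K) 1 0) * ((P : Matrix (Fin 2) (Fin 2) K) 0 0)⁻¹ * (P : Matrix (Fin 2) (Fin 2) K) 0 1] := rfl
      have hkI : k ∈ glInt 2 K := by
        refine mem_glInt_of_isIntegralMatrix (fun i j => ?_) ?_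
        · rw [← v_le_one_iff_mem_integer, hk]
          fin_cases i <;> fin_cases j
          · exact hPint 0 0
          · change Valued.v (ϖ * (P : Matrix (Fin 2) (Fin 2) K) 0 1) ≤ 1
            rw [map_mul]; exact mul_le_one' (by rw [hd.vϖ, ← WithZero.exp_zero, WithZero.exp_le_exp]; norm_num) (hPint 0 1)
          · change Valued.v (0 : K) ≤ 1
            rw [map_zero]; exact zero_le
          · change Valued.v ((P : Matrix (Fin 2) (Fin 2) K) 1 1 - ((P : Matrix (Fin 2) (Fin 2) K) 1 0) * ((P : Matrix (Fin 2) (Fin 2) K) 0 0)⁻¹ * (P : Matrix (Fin 2) (Fin 2) K) 0 1) ≤ 1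
            refine Valuation.map_sub_le _ (hPint 1 1) ?_
            rw [map_mul]; exact mul_le_one' ((v_le_one_iff_mem_integer _).2 htO) (hPint 0 1)
        · rw [← v_eq_one_iff_valuation_eq_one, hk, hkdet]; exact hdetP
      have hprod : ((L * zpowDiagGL (n := 2) hϖ0 ![0, 1]) * k : GL (Fin 2) K) = P * zpowDiagGL (n := 2) hϖ0 ![0, 1] := by
        apply Units.ext
        rw [Units.val_mul, Units.val_mul, Units.val_mul, hk, hLt, coe_zpowDiagGL_two, zpow_zero, zpow_one, hd2]
        conv_rhs => rw [Matrix.eta_fin_two (P : Matrix (Fin 2) (Fin 2) K)]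
        rw [Matrix.mul_fin_two, Matrix.mul_fin_two, Matrix.mul_fin_two]
        ext i j
        fin_cases i <;> fin_cases j
        · simp
        · simp [mul_comm]
        · simp; field_simp
        · simp; field_simp; ring
      rw [hD, ← Units.val_mul, ← Units.val_mul, ← hprod, latt_mul_of_mem_glInt _ k hkI]
  · -- `((P : Matrix (Fin 2) (Fin 2) K) 0 0) ∈ 𝔪`: then `((P : Matrix (Fin 2) (Fin 2) K) 1 0)` is a unit and `Λ = Λ_∞`
    right
    have hxlt : Valued.v ((P : Matrix (Fin 2) (Fin 2) K) 0 0) < 1 := lt_of_le_of_ne (hPint 0 0) hxu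
    have hxϖ : Valued.v ((P : Matrix (Fin 2) (Fin 2) K) 0 0) ≤ Valued.v ϖ := by rw [hd.vϖ]; exact (HermitianLattice.v_lt_one_iff ((P : Matrix (Fin 2) (Fin 2) K) 0 0)).1 hxlt
    have hyu : Valued.v ((P : Matrix (Fin 2) (Fin 2) K) 1 0) = 1 := by
      by_contra hne
      have hylt : Valued.v ((P : Matrix (Fin 2) (Fin 2) K) 1 0) < 1 := lt_of_le_of_ne (hPint 1 0) hne
      have hlt : Valued.v (P : Matrix (Fin 2) (Fin 2) K).det < 1 := by
        rw [Matrix.det_fin_two, sub_eq_add_neg]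
        refine Valuation.map_add_lt _ ?_ ?_
        · rw [map_mul]; exact mul_lt_one_of_lt_of_le hxlt (hPint 1 1)
        · rw [Valuation.map_neg, map_mul]; exact Right.mul_lt_one_of_le_of_lt (hPint 0 1) hylt
      rw [hdetP] at hlt
      exact lt_irrefl _ hlt
    let w : GL (Fin 2) K := Matrix.GeneralLinearGroup.mkOfDetNeZero !![(0 : K), 1; 1, 0] (by simp [Matrix.det_fin_two_of])
    have hw : (w : Matrix (Fin 2) (Fin 2) K) = !![(0 : K), 1; 1, 0] := rfl
    refine ⟨w, hw, ?_⟩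
    rw [hΛP]
    -- `(w·D)·k = P·D` with `k = !![y, ϖ P₁₁; x/ϖ, P₀₁] ∈ GL₂(𝒪)`
    have hkdet : (!![((P : Matrix (Fin 2) (Fin 2) K) 1 0), ϖ * (P : Matrix (Fin 2) (Fin 2) K) 1 1; ((P : Matrix (Fin 2) (Fin 2) K) 0 0) * ϖ⁻¹, (P : Matrix (Fin 2) (Fin 2) K) 0 1]).det = -(P : Matrix (Fin 2) (Fin 2) K).det := by
      rw [Matrix.det_fin_two_of, Matrix.det_fin_two]; field_simp; ring
    have hkne : (!![((P : Matrix (Fin 2) (Fin 2) K) 1 0), ϖ * (P : Matrix (Fin 2) (Fin 2) K) 1 1; ((P : Matrix (Fin 2) (Fin 2) K) 0 0) * ϖ⁻¹, (P : Matrix (Fin 2) (Fin 2) K) 0 1]).det ≠ 0 := by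
      rw [hkdet, neg_ne_zero]; exact (Matrix.isUnits_det_units P).ne_zero
    let k : GL (Fin 2) K := Matrix.GeneralLinearGroup.mkOfDetNeZero _ hkne
    have hk : (k : Matrix (Fin 2) (Fin 2) K) = !![((P : Matrix (Fin 2) (Fin 2) K) 1 0), ϖ * (P : Matrix (Fin 2) (Fin 2) K) 1 1; ((P : Matrix (Fin 2) (Fin 2) K) 0 0) * ϖ⁻¹, (P : Matrix (Fin 2) (Fin 2) K) 0 1] := rfl
    have hkI : k ∈ glInt 2 K := by
      refine mem_glInt_of_isIntegralMatrix (fun i j => ?_) ?_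
      · rw [← v_le_one_iff_mem_integer, hk]
        fin_cases i <;> fin_cases j
        · exact hPint 1 0
        · change Valued.v (ϖ * (P : Matrix (Fin 2) (Fin 2) K) 1 1) ≤ 1
          rw [map_mul]; exact mul_le_one' (by rw [hd.vϖ, ← WithZero.exp_zero, WithZero.exp_le_exp]; norm_num) (hPint 1 1)
        · change Valued.v (((P : Matrix (Fin 2) (Fin 2) K) 0 0) * ϖ⁻¹) ≤ 1
          rw [map_mul, map_inv₀]
          calc Valued.v ((P : Matrix (Fin 2) (Fin 2) K) 0 0) * (Valued.v ϖ)⁻¹ ≤ Valued.v ϖ * (Valued.v ϖ)⁻¹ := mul_le_mul_left hxϖ _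
            _ = 1 := mul_inv_cancel₀ (by rw [hd.vϖ]; exact WithZero.exp_ne_zero)
        · exact hPint 0 1
      · rw [← v_eq_one_iff_valuation_eq_one, hk, hkdet, Valuation.map_neg]; exact hdetP
    have hprod : ((w * zpowDiagGL (n := 2) hϖ0 ![0, 1]) * k : GL (Fin 2) K) = P * zpowDiagGL (n := 2) hϖ0 ![0, 1] := by
      apply Units.ext
      rw [Units.val_mul, Units.val_mul, Units.val_mul, hk, hw, coe_zpowDiagGL_two, zpow_zero, zpow_one, hd2]
      conv_rhs => rw [Matrix.eta_fin_two (P : Matrix (Fin 2) (Fin 2) K)]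
      rw [Matrix.mul_fin_two, Matrix.mul_fin_two, Matrix.mul_fin_two]
      ext i j
      fin_cases i <;> fin_cases j
      · simp; field_simp
      · simp [mul_comm]
      · simp
      · simp [mul_comm]
    rw [hD, ← Units.val_mul, ← Units.val_mul, ← hprod, latt_mul_of_mem_glInt _ k hkI]

/-- **The parametrisation is faithful**: `Λ_t = Λ_{t′}` iff `t ≡ t′ (mod 𝔪)`, and `Λ_t ≠ Λ_∞` (compare `L_{t′}·D = (L_t·D)·k`, `k ∈ GL₂(𝒪)`, entrywise).
[cite: Serre1980Trees, II.1.1] -/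
theorem latt_lowerUnipotent_eq_iff (hd : HermitianLattice.UnramifiedLocalConjDatum σ ϖ) (t t' : 𝒪[K])
    (L : GL (Fin 2) K) (hLt : (L : Matrix (Fin 2) (Fin 2) K) = !![(1 : K), 0; (t : K), 1])
    (L' : GL (Fin 2) K) (hLt' : (L' : Matrix (Fin 2) (Fin 2) K) = !![(1 : K), 0; (t' : K), 1])
    (w : GL (Fin 2) K) (hw : (w : Matrix (Fin 2) (Fin 2) K) = !![(0 : K), 1; 1, 0]) :
    (latt ((L : Matrix (Fin 2) (Fin 2) K) * Matrix.diagonal ![ϖ ^ (0 : ℤ), ϖ ^ (1 : ℤ)]) =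
        latt ((L' : Matrix (Fin 2) (Fin 2) K) * Matrix.diagonal ![ϖ ^ (0 : ℤ), ϖ ^ (1 : ℤ)]) ↔
      IsLocalRing.residue 𝒪[K] t = IsLocalRing.residue 𝒪[K] t') ∧
    latt ((L : Matrix (Fin 2) (Fin 2) K) * Matrix.diagonal ![ϖ ^ (0 : ℤ), ϖ ^ (1 : ℤ)]) ≠
      latt ((w : Matrix (Fin 2) (Fin 2) K) * Matrix.diagonal ![ϖ ^ (0 : ℤ), ϖ ^ (1 : ℤ)]) := by
  have hϖ := isUniformizingElement_of_v_eq hd.vϖ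
  have hϖ0 : ϖ ≠ 0 := hϖ.ne_zero
  have hD : Matrix.diagonal ![ϖ ^ (0 : ℤ), ϖ ^ (1 : ℤ)] = ((zpowDiagGL (n := 2) hϖ0 ![0, 1] : GL (Fin 2) K) : Matrix (Fin 2) (Fin 2) K) :=
    (coe_zpowDiagGL_two hϖ0 0 1).symm
  have hd2 : (Matrix.diagonal ![(1 : K), ϖ]) = !![(1 : K), 0; 0, ϖ] := by
    ext i j; fin_cases i <;> fin_cases j <;> simp
  -- residues agree iff the difference has valuation `< 1`
  have hres : IsLocalRing.residue 𝒪[K] t = IsLocalRing.residue 𝒪[K] t' ↔ valuation K ((t : K) - t') < 1 := by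
    rw [← sub_eq_zero, ← map_sub, residue_eq_zero_iff_valuation_lt_one, AddSubgroupClass.coe_sub]
  constructor
  · rw [hres, hD, ← Units.val_mul, ← Units.val_mul]
    constructor
    · intro h
      -- `L'·D = (L·D)·k`, `k ∈ GL₂(𝒪)`: entry `(1,0)` gives `t′ = t + ϖ k₁₀`
      obtain hk := (span_range_transpose_eq_iff _ _).1 h
      set k : GL (Fin 2) K := (L * zpowDiagGL (n := 2) hϖ0 ![0, 1])⁻¹ * (L' * zpowDiagGL (n := 2) hϖ0 ![0, 1]) with hkdef
      have hkint := ((mem_glInt_iff_forall_v_le_one k).1 hk).1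
      have heq : (L' * zpowDiagGL (n := 2) hϖ0 ![0, 1] : GL (Fin 2) K) = (L * zpowDiagGL (n := 2) hϖ0 ![0, 1]) * k := by
        rw [hkdef, mul_inv_cancel_left]
      have hc := congrArg (fun g : GL (Fin 2) K => (g : Matrix (Fin 2) (Fin 2) K)) heq
      simp only [Units.val_mul, hLt, hLt', coe_zpowDiagGL_two, zpow_zero, zpow_one, hd2] at hc
      rw [Matrix.eta_fin_two (k : Matrix (Fin 2) (Fin 2) K), Matrix.mul_fin_two, Matrix.mul_fin_two, Matrix.mul_fin_two] at hc
      have h00 := congrArg (fun M : Matrix (Fin 2) (Fin 2) K => M 0 0) hc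
      have h10 := congrArg (fun M : Matrix (Fin 2) (Fin 2) K => M 1 0) hc
      simp at h00 h10
      -- `h00 : 1 = k₀₀`, `h10 : t' = t * k₀₀ + ϖ * k₁₀`
      rw [← h00] at h10
      have hdiff : (t : K) - t' = -(ϖ * (k : Matrix (Fin 2) (Fin 2) K) 1 0) := by rw [h10]; ring
      rw [← v_lt_one_iff_valuation_lt_one, hdiff, Valuation.map_neg, map_mul, hd.vϖ]
      calc WithZero.exp (-1 : ℤ) * Valued.v ((k : Matrix (Fin 2) (Fin 2) K) 1 0) ≤ WithZero.exp (-1 : ℤ) * 1 := mul_le_mul_right (hkint 1 0) _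
        _ < 1 := by rw [mul_one, ← WithZero.exp_zero, WithZero.exp_lt_exp]; norm_num
    · intro h
      -- `t − t′ = ϖ s`, `s ∈ 𝒪`: `L'·D = (L·D)·!![1,0;−s... ]`; use the lower unipotent `!![1, 0; (t′−t)/ϖ, 1] ∈ GL₂(𝒪)`
      have hsO : ((t' : K) - t) * ϖ⁻¹ ∈ 𝒪[K] := by
        rw [← v_le_one_iff_mem_integer, map_mul, map_inv₀, hd.vϖ, ← Valuation.map_neg, neg_sub]
        have h' : Valued.v ((t : K) - t') ≤ WithZero.exp (-1 : ℤ) := (HermitianLattice.v_lt_one_iff _).1 ((v_lt_one_iff_valuation_lt_one _).2 h)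
        calc Valued.v ((t : K) - t') * (WithZero.exp (-1 : ℤ))⁻¹ ≤ WithZero.exp (-1 : ℤ) * (WithZero.exp (-1 : ℤ))⁻¹ := mul_le_mul_left h' _
          _ = 1 := mul_inv_cancel₀ WithZero.exp_ne_zero
      obtain ⟨U, hU, hUs⟩ := exists_glInt_coe_eq_lowerUnipotent_two (⟨((t' : K) - t) * ϖ⁻¹, hsO⟩ : 𝒪[K])
      have hprod : ((L * zpowDiagGL (n := 2) hϖ0 ![0, 1]) * U : GL (Fin 2) K) = L' * zpowDiagGL (n := 2) hϖ0 ![0, 1] := by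
        apply Units.ext
        rw [Units.val_mul, Units.val_mul, Units.val_mul, hUs, hLt, hLt', coe_zpowDiagGL_two, zpow_zero, zpow_one, hd2,
          Matrix.mul_fin_two, Matrix.mul_fin_two, Matrix.mul_fin_two]
        ext i j
        fin_cases i <;> fin_cases j
        · simp
        · simp
        · simp; field_simp; ring
        · simp
      rw [← hprod, latt_mul_of_mem_glInt _ U hU]
  · rw [hD, ← Units.val_mul, ← Units.val_mul]
    intro h
    -- `L·D = (w·D)·k`: entry `(0,0)` reads `1 = ϖ·k₁₀`, impossible for integral `k₁₀`
    obtain hk := (span_range_transpose_eq_iff _ _).1 h.symm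
    set k : GL (Fin 2) K := (w * zpowDiagGL (n := 2) hϖ0 ![0, 1])⁻¹ * (L * zpowDiagGL (n := 2) hϖ0 ![0, 1]) with hkdef
    have hkint := ((mem_glInt_iff_forall_v_le_one k).1 hk).1
    have heq : (L * zpowDiagGL (n := 2) hϖ0 ![0, 1] : GL (Fin 2) K) = (w * zpowDiagGL (n := 2) hϖ0 ![0, 1]) * k := by
      rw [hkdef, mul_inv_cancel_left]
    have hc := congrArg (fun g : GL (Fin 2) K => (g : Matrix (Fin 2) (Fin 2) K)) heq
    simp only [Units.val_mul, hLt, hw, coe_zpowDiagGL_two, zpow_zero, zpow_one, hd2] at hc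
    rw [Matrix.eta_fin_two (k : Matrix (Fin 2) (Fin 2) K), Matrix.mul_fin_two, Matrix.mul_fin_two, Matrix.mul_fin_two] at hc
    have h00 := congrArg (fun M : Matrix (Fin 2) (Fin 2) K => M 0 0) hc
    simp at h00
    -- `h00 : 1 = ϖ * k₁₀`
    have hv := congrArg Valued.v h00
    rw [map_one, map_mul, hd.vϖ] at hv
    have hlt : WithZero.exp (-1 : ℤ) * Valued.v ((k : Matrix (Fin 2) (Fin 2) K) 1 0) < 1 :=
      calc WithZero.exp (-1 : ℤ) * Valued.v ((k : Matrix (Fin 2) (Fin 2) K) 1 0) ≤ WithZero.exp (-1 : ℤ) * 1 := mul_le_mul_right (hkint 1 0) _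
        _ < 1 := by rw [mul_one, ← WithZero.exp_zero, WithZero.exp_lt_exp]; norm_num
    rw [← hv] at hlt
    exact lt_irrefl _ hlt

end Two

end Summit.HodgeConjecture.HodgeConjecture.R90.S6

end
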